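import Summits.KontsevichZagierPeriods.KontsevichZagierPeriods.Theorems.RealOnePeriodRelations.Negative.Kit

/-!
# `RealOnePeriodRelations` (stmt-KontsevichZagierPeriods-10042) — negative side II: the hypothesis `c ∈ H₁` is load-bearing

`realOnePeriodRelations_false_without_H₁`: with the hypothesis `c ∈ H₁` dropped the statement is FALSE —
witness `c = [1]₀ − [∫₀¹ 1]₁`, which has `eval c = 0` but `c ∉ M₁`, because `M₁` is generated by
SAME-DIMENSION instances of rules 1a/1b/2 (sound in each dimension by the tree's soundness theorems)
and by Green (dimension one), so the dimension-zero evaluation `evalDim₀` kills `M₁`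
(`M₁_le_ker_evalDim₀`) while `evalDim₀ c = 1`. ANY proof of the crux must therefore use `c ∈ H₁`;
and users (the compiler crux `PlanarCompiler`) get no cross-dimension move from it. (The companion
`false_without_eval` needs the soundness of Green, `Negative/GreenSound`, and lands separately.)
[Kontsevich–Zagier 2001, §1.2]
-/

noncomputable section

open scoped BigOperators Topology
open Set MeasureTheory Filter
open Literature.NumberTheory.Transcendental

namespace Summit.KontsevichZagierPeriods.SymplecticScissors.RealOnePeriodRelationsNegative

/-! ### §3.3 Dropping `c ∈ H₁` -/

/-- The crux WITHOUT the hypothesis `c ∈ H₁` (a refuter-posited deletion variant for the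
load-bearing test, not a statement from the literature): every vanishing combination of
representations of ALL dimensions lies in `M₁` (rules 1a/1b/2 in all dimensions + Green). -/
def RealOnePeriodRelationsWithoutH₁ : Prop :=
  ∀ c : KZ.FormalRep, KZ.eval c = 0 → c ∈ M₁

/-- Evaluation of the DIMENSION-ZERO part of a formal combination. [folklore] -/
def evalDim₀ : KZ.FormalRep →+ ℝ :=
  FreeAbelianGroup.lift fun x : (Σ n, KZ.IntegralRep n) => if x.1 = 0 then x.2.value else 0

/-- `evalDim₀` on a generator. [folklore] -/
theorem evalDim₀_of {n : ℕ} (r : KZ.IntegralRep n) :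
    evalDim₀ (KZ.of r) = if n = 0 then r.value else 0 :=
  FreeAbelianGroup.lift_apply_of _ _

/-- `M₁` is GRADED by dimension and sound in each degree, so it lies in the kernel of the
dimension-zero evaluation (no Green soundness needed: Green lives in dimension one). [folklore] -/
theorem M₁_le_ker_evalDim₀ : M₁ ≤ evalDim₀.ker := by
  refine (AddSubgroup.closure_le _).mpr ?_
  rintro c (((hc | hc) | hc) | hc)
  · obtain ⟨n, r, r₁, r₂, hdom, hnull, h₁, h₂, rfl⟩ := hc
    have hs := KZ.eval_eq_zero_of_mem_domainAddRel_holds ⟨n, r, r₁, r₂, hdom, hnull, h₁, h₂, rfl⟩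
    simp only [map_sub, KZ.eval_of] at hs
    simp only [SetLike.mem_coe, AddMonoidHom.mem_ker, map_sub, evalDim₀_of]
    by_cases hn : n = 0
    · subst hn; simpa using hs
    · simp [hn]
  · obtain ⟨n, r, r₁, r₂, h₁, h₂, hadd, rfl⟩ := hc
    have hs := KZ.eval_eq_zero_of_mem_integrandAddRel_holds ⟨n, r, r₁, r₂, h₁, h₂, hadd, rfl⟩
    simp only [map_sub, KZ.eval_of] at hs
    simp only [SetLike.mem_coe, AddMonoidHom.mem_ker, map_sub, evalDim₀_of]
    by_cases hn : n = 0
    · subst hn; simpa using hs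
    · simp [hn]
  · obtain ⟨n, r, r', Φ, Φ', hΦ, hΦ', hinj, hdom, hf, rfl⟩ := hc
    have hs := KZ.eval_eq_zero_of_mem_changeOfVariablesRel_holds
      ⟨n, r, r', Φ, Φ', hΦ, hΦ', hinj, hdom, hf, rfl⟩
    simp only [map_sub, KZ.eval_of] at hs
    simp only [SetLike.mem_coe, AddMonoidHom.mem_ker, map_sub, evalDim₀_of]
    by_cases hn : n = 0
    · subst hn; simpa using hs
    · simp [hn]
  · obtain ⟨Δ', A, B, S, r₀₁, r₁₂, r₀₂, -, -, -, -, -, -, -, -, -, -, -, -, rfl⟩ := hc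
    simp [evalDim₀_of]

/-- **`c ∈ H₁` is load-bearing**: without it the statement is false — `c = [1]₀ − [∫₀¹ 1]₁` has
`eval c = 0` but `c ∉ M₁`, because `M₁` is generated by SAME-DIMENSION instances and is sound in
each dimension separately (`evalDim₀ c = 1`). The same witness pattern works with `[unit square]₂`
in place of `[1]₀`. Moral for users (PlanarCompiler): the crux supplies no cross-dimension move;
dimension bookkeeping is the caller's. [cite: KontsevichZagier2001, §1.2] -/
theorem realOnePeriodRelations_false_without_H₁ : ¬ RealOnePeriodRelationsWithoutH₁ := by
  intro h
  have heval : KZ.eval (KZ.of (constRep₀ 1) - KZ.of (constRep₁ 1)) = 0 := by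
    simp [map_sub, KZ.eval_of]
  have hker := M₁_le_ker_evalDim₀ (h _ heval)
  rw [AddMonoidHom.mem_ker, map_sub, evalDim₀_of, evalDim₀_of] at hker
  simp at hker

end Summit.KontsevichZagierPeriods.SymplecticScissors.RealOnePeriodRelationsNegative

end
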